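import Mathlib.GroupTheory.SpecificGroups.Dihedral
import Literature.Combinatorics.Additive.TripleProductProperty
import Summits.MatrixMultiplication.OmegaCensus.DihedralLawComplete
import HarnessLib

/-!
# `β(C₄ × D₁₄) ≥ 72 > 64 = |C₄|·β(D₁₄)`: the product law fails already on the CYCLIC-index-2 class

ω-census, family (b).  Framing: lottery ticket; floor = certified bounds/negative ranges.

A kernel-checked (`decide`) TPP triple of type `(2,4,9)` (volume `72`) in `C₄ × D₁₄ =
Multiplicative (ZMod 4) × DihedralGroup 7` (order `56`; it has the element `(1, r 1)` of order `28 = |G|/2`, so it lies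
in the cyclic-index-2 class).  Since `β(D₁₄) = 4⌊14/3⌋ = 16` (`dihedral_law`), this shows
`β(C₄ × D₁₄) ≥ 72 > 64 = |C₄|·β(D₁₄)`: the 'product law' `β(C_m × D_{2n}) = m·β(D_{2n})`, which holds for the eight
cyclic cases of order `≤ 48` computed by this cell (ℤ₃×D₈ … ℤ₃×D₁₆), FAILS from order `56` on — as first reported by the
speedrun lane `tpp` census (seat sr-tpp-search-g10, exact `β(C₄×D₁₄) = 72`); the witness below was found
independently by this seat's exhaustive enumerator (`code/esp/tpp_exact.py`, pattern `(2,4,9)`, 42 s) and is a second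
leg for that census value's lower side.  Also `3·72 = 216 < 224 = 4·56`, so this group is NOT a counterexample to
HM12 Conj. 7.6 (those start at order 70: `CyclicSevenDihedralTenTPP96`).
-/

namespace Summit.MatrixMultiplication.OmegaCensus

open Literature.Combinatorics.Additive Finset

/-- **A `(2,4,9)` TPP triple of `C₄ × D₁₄`** (volume `72`; kernel `decide`). [folklore] -/
theorem c4_d14_tpp_249 :
    TripleProductProperty
      ({(Multiplicative.ofAdd (0 : ZMod 4), DihedralGroup.r (0 : ZMod 7)),
        (Multiplicative.ofAdd (0 : ZMod 4), DihedralGroup.sr (0 : ZMod 7))} :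
        Finset (Multiplicative (ZMod 4) × DihedralGroup 7))
      ({(Multiplicative.ofAdd (0 : ZMod 4), DihedralGroup.r (0 : ZMod 7)),
        (Multiplicative.ofAdd (1 : ZMod 4), DihedralGroup.r (0 : ZMod 7)),
        (Multiplicative.ofAdd (2 : ZMod 4), DihedralGroup.sr (1 : ZMod 7)),
        (Multiplicative.ofAdd (3 : ZMod 4), DihedralGroup.sr (1 : ZMod 7))} :
        Finset (Multiplicative (ZMod 4) × DihedralGroup 7))
      ({(Multiplicative.ofAdd (0 : ZMod 4), DihedralGroup.r (0 : ZMod 7)),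
        (Multiplicative.ofAdd (0 : ZMod 4), DihedralGroup.r (1 : ZMod 7)),
        (Multiplicative.ofAdd (0 : ZMod 4), DihedralGroup.r (2 : ZMod 7)),
        (Multiplicative.ofAdd (0 : ZMod 4), DihedralGroup.sr (3 : ZMod 7)),
        (Multiplicative.ofAdd (0 : ZMod 4), DihedralGroup.sr (4 : ZMod 7)),
        (Multiplicative.ofAdd (2 : ZMod 4), DihedralGroup.r (4 : ZMod 7)),
        (Multiplicative.ofAdd (2 : ZMod 4), DihedralGroup.r (5 : ZMod 7)),
        (Multiplicative.ofAdd (2 : ZMod 4), DihedralGroup.sr (0 : ZMod 7)),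
        (Multiplicative.ofAdd (2 : ZMod 4), DihedralGroup.sr (6 : ZMod 7))} :
        Finset (Multiplicative (ZMod 4) × DihedralGroup 7)) := by
  unfold TripleProductProperty; decide +kernel

/-- **`β(C₄ × D₁₄) ≥ 72`.** [folklore] -/
theorem beta_c4_d14_ge_72 :
    ∃ S T U : Finset (Multiplicative (ZMod 4) × DihedralGroup 7), TripleProductProperty S T U ∧
      S.card * T.card * U.card = 72 :=
  ⟨_, _, _, c4_d14_tpp_249, by decide +kernel⟩

/-- **Strict supermultiplicativity on the cyclic-index-2 class**: `β(C₄ × D₁₄) ≥ 72 > 4·16 = |C₄|·β(D₁₄)` (every TPP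
triple of `D₁₄` has volume `≤ 16`, `dihedral_law`). [folklore] -/
theorem beta_c4_d14_gt_product :
    (∃ S T U : Finset (Multiplicative (ZMod 4) × DihedralGroup 7), TripleProductProperty S T U ∧
      S.card * T.card * U.card = 72) ∧
    (∀ S T U : Finset (DihedralGroup 7), TripleProductProperty S T U → S.card * T.card * U.card ≤ 16) ∧
    4 * 16 < 72 :=
  ⟨beta_c4_d14_ge_72, fun S T U h => by simpa using (dihedral_law (n := 7) (by norm_num)).1 S T U h, by norm_num⟩

/-- `(1, r 1)` has order `28 = |G|/2`: `C₄ × D₁₄` has a cyclic subgroup of index 2. [folklore] -/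
theorem c4_d14_two_mul_orderOf :
    2 * orderOf ((Multiplicative.ofAdd (1 : ZMod 4), DihedralGroup.r (1 : ZMod 7)) : Multiplicative (ZMod 4) × DihedralGroup 7) =
      Fintype.card (Multiplicative (ZMod 4) × DihedralGroup 7) := by
  rw [Prod.orderOf_mk, orderOf_ofAdd_eq_addOrderOf, ZMod.addOrderOf_one, DihedralGroup.orderOf_r_one]
  simp [Fintype.card_prod, ZMod.card, DihedralGroup.card]; decide

end Summit.MatrixMultiplication.OmegaCensus
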